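import Literature.NumberTheory.EllipticCurves.BipartiteToricPeriod
import Literature.NumberTheory.GaloisRepresentations.IntegralGaloisAction
import HarnessLib

/-!
# Bertolini–Longo–Venerucci 2026, Thm. B at the trivial character (definite, good ordinary): `#Sel_{p^∞}(E/K) = p^{2·ord_p ψ_f(P_K)}`

Named fact (D-0014; nothing asserted) vendoring ONE published theorem, in the shape the X9 lane of
the cell `b2b-bsdres` consumes it (rank-`0` pairs `(E, 5)` with `N = ℓ·M²`, `ℓ` the unique
multiplicative prime, `ρ̄_{E,5}` irreducible NOT surjective of type `5S4`):

* M. Bertolini, M. Longo, R. Venerucci, *The anticyclotomic main conjectures for elliptic curves*,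
  Math. Ann. (2026), doi:10.1007/s00208-026-03381-0 [BertoliniLongoVenerucci2026]
  (= arXiv:2306.17784 [BertoliniLongoVenerucci2023]; text read: the arXiv version materialised as
  `paper:arxiv-2306.17784`, chunk numbers `pNNNN` below; the published version is requested from
  the acquisition queue for a line-by-line comparison of §3, see the READING FLAGS).

HONEST FRAMING (cell `b2b-bsdres`): published theorems are cited verbatim with their hypotheses;
the cell's class X9 stays TYPED at class level; this file introduces no class statement.

## The printed statements (verbatim, with locators)

* **Hypothesis 1.1** [p0003 L10–L20]: "• The rational prime `p` is `⩾ 5` and does not divide `N` and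
  the class number `h_K` of `K`. • The representation `ρ̄_{E,p} : G_ℚ → GL₂(𝔽_p)` arising from the
  `p`-torsion `E(ℚ̄)_p` of `E` is irreducible. • `N⁻` is squarefree. • If `E/ℚ_p` has good ordinary
  reduction, then `a_p(E) ≢ ±1 (mod p)`. • If `q` is a prime dividing `N⁺`, then `H⁰(I_{ℚ_q}, E_p) = 0`.
  • If `q ∥ N⁻` and `q ≡ ±1 mod p`, then `ρ̄_{E,p}` is ramified at `q`."  Here [p0003 L8–L9] "Let `N`
  be as above the conductor of `E`, assumed to be coprime with the discriminant of `K`. Factor `N`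
  as `N = N⁺N⁻`, where `N⁺` resp. `N⁻` is divisible only by primes which are split, resp. inert in `K`";
  the DEFINITE case is "`N⁻` has an odd number of prime divisors" [p0002 L7–L12, §2.1 p0005 L8].
* **Theorem B (definite BSD formulas)** [p0003 L46–L52]: "Let `χ` be a finite order character of
  conductor `p^n` of the Galois group of `K_∞/K`. Then `Sel(K, A_f(χ))` is finite if and only if
  `L(E/K,χ,1) ≠ 0`. In this case one has `length_{𝒪_χ}(Sel(K, A_f(χ))) ⩽ ord_χ(L(E/K,χ,1)/C)` with
  equality in the non-exceptional case."  (Def. 1.2 [p0003 L22]: exceptional = supersingular at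
  `p`, `p` inert, `ε = +`; the good ORDINARY case is never exceptional.)  Remark 1.3 [p0003 L64]:
  "The case `n = 0` can be obtained more directly by applying [S-U] … In the non-exceptional case it
  follows as well from the AMC's proved in this paper."
* **§9.2 Proof of Theorem B, Step 1** [p0040 L24–L68]: "We first show that
  `length_{𝒪_χ}(Sel(K, A_f(χ))) ⩽ ord_χ(χ(L_{p,n}(f)))` with equality in the non-exceptional case",
  with `L_{p,n}(f) = 𝓛_{f,n}·(𝓛_{f,n})^ι ∈ ℤ_p[G_n]` [p0040 L26] and, in the non-exceptional case,
  "`length_{𝒪_χ}(Sel(K,A_f(χ))) = … = 2·ord_χ(𝓛_{f,n}(χ̄))`" [p0040 L62–L68], from **Theorem 7.1**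
  [p0026 L36]: "Assume that `𝓛_g^ε(χ̄) ≠ 0`. Then `length_{𝒪_χ}(Sel_ε(K, A_g(χ))) ⩽ 2 ord_χ(𝓛_g^ε(χ̄))`,
  with equality in the non-exceptional case."  Step 2 [p0040 L80–L92] rewrites `χ(L_p(f))` as
  `L(E/K,χ,1)/C`, `C = √D p^n/Ω` with `Ω` Gross' period, by Gross's special value formula.
* **§4.2, the ordinary case** [p0010 L66–L109]: `𝓛_g = lim 𝓛_{g,n}`,
  "`𝓛_g(𝟙) = (1/u_K)(1 − α_p(g)²)·ψ_g(P_K(L))` if `ε_K(p) = −1`, `(−1/u_K)(1 − α_p(g))²·ψ_g(P_K(L))` if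
  `ε_K(p) = +1`" and **Lemma 4.1** [p0010 L107]: "The equality `𝓛_g(𝟙) = ψ_g(P_K(L))` holds in `R` up
  to multiplication by an element in `R^*`" (proof: "Hypothesis 5.2 (1)" = `a_p ≢ ±1`).  Here
  `k = ∞`, `L = 1`, `g = f`, `R = ℤ_p` [p0010 L8–L15], `ψ_g : J_{N⁺,N⁻} ⊗ ℤ_p → R` is the surjective
  `𝐓`-equivariant functional, "uniquely determined by `g` up to multiplication by a `p`-adic unit"
  [p0010 L49–L55], `J_{N⁺,N⁻} = Pic(X_{N⁺,N⁻})` "a free ℤ-module of rank equal to the number of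
  connected components of the Gross curve" [p0005 L95–L98], `X_{N⁺,N⁻} = ∐_j Γ_j \ 𝒞` indexed by the
  "conjugacy classes of (oriented) Eichler orders of level `N⁺`" in the definite quaternion algebra
  of discriminant `N⁻` [p0005 L63–L74], the Hecke operators `T_ℓ` (`ℓ ∤ N`) [p0005 L88–L93], and
  **`P_K = Σ_{σ ∈ Pic(𝒪_K)} σ(P̃₀)`** [p0007 L16–L18] for a Gross point `P̃₀` of conductor `1`
  [§2.4, p0006 L28–L45: "`f(K) ∩ g⁻¹R̂^*g = f(𝒪_{p^n})`", `n = 0`], with the algebraic action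
  `σ(g × f) = (g f̂(𝔞) × f)` of `Pic(𝒪_K)` [p0006 L50–L58].
* **§5.2.5** [p0017 L28–L46] defines the discrete Selmer group `Sel(K, A_f(χ))` by the local
  conditions finite at `p` (§5.2.1: `E(K_{∞,𝔭}) ⊗ ℚ_p/ℤ_p` pulled back), ordinary at `N⁻`, trivial at
  `N⁺`, unramified elsewhere; the Introduction calls these "the usual Selmer groups" /
  "the standard Selmer groups" [p0003 L42–L44].  At `χ = 𝟙`, `A_f(𝔓_𝟙) = A_f = Hom(T_f, μ_{p^∞}) ≅ E[p^∞]`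
  (Weil pairing, §5.2 first lines [p0015 L29–L33]).

## What is vendored (the case `n = 0`, `χ = 𝟙`, `ε = ∅`: good ordinary, definite)

`BLV2026_card_selmerGroupPInfty_eq_pow_of_grossPeriod`: under Hypothesis 1.1 in the definite case,
with `S := ψ_f(P_K) ∈ ℤ` the value of the PRIMITIVE integral `f`-eigenfunctional on the Gross divisor,
if `S ≠ 0` then `#Sel_{p^∞}(E/K) = p^{2·ord_p S}` (Thm. B ∧ Step 1 ∧ Lemma 4.1: `length_{ℤ_p} Sel(K,A_f)
= ord_p 𝟙(L_p(f)) = 2·ord_p 𝓛_f(𝟙) = 2·ord_p ψ_f(P_K)`; `u_K, 1 − α_p², (1 − α_p)²` are `p`-units by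
`p ⩾ 5` and `a_p ≢ ±1`).  In particular (`selmerGroupPInfty_baseChange_eq_bot_of_BLV2026`, PROVED from
the fact): `p ∤ S ⟹ Sel_{p^∞}(E/K) = 0`.

## Typing (Mathlib + tree vocabulary; the dictionary, binder by binder)

The curve/field side uses the tree's `HasGoodReductionAtPrime`, `frobeniusTrace` (`a_p`),
`HasIrreducibleModPGaloisRep`, `conductorNorm ℤ`, `geomTorsion W p` with its `Γ_ℚ`-action and the
inertia groups `𝔓.inertia Γ_ℚ` of primes `𝔓` of `ℤ̄ = absIntegers (𝓞 ℚ) ℚ` (Hyp. 1.1 bullets 5–6,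
VERBATIM: `H⁰(I_q, E[p]) = 0` for `q ∣ N⁺`; ramified at `q ∣ N⁻` with `q ≡ ±1`), `ClassGroup (𝓞 K)`
(`p ∤ h_K`), `primesOver` (split / inert), and `WeierstrassCurve.selmerGroupPInfty (W.baseChange K) p`
(`Sel_{p^∞}(E/K)`, `Selmer.lean`).  The quaternionic side is typed EXACTLY as in the tree's Kim-2024
toric-period fact `kim_selmerCorank_baseChange_le_of_toricPeriod_ne_zero` (`BipartiteToricPeriod.lean`,
whose module docstring gives the dictionary and its sources: Gross 1987 §3, Voight §30, BD96 §1.9):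
`B = QuaternionAlgebra ℚ a 0 b` definite, a division algebra at `q` iff `q ∣ N⁻`; `O = O₁ ⊓ O₂` an
Eichler order of level `N⁺`; `RI` the invertible right `O`-ideals (`= B̂^×/R̂^×`); a function on `RI`
invariant under `J ↦ βJ` is a function on the class set, i.e. a functional on `J_{N⁺,N⁻}`; `IsEig g` =
`B^×`-invariance + `Σ_{J' ⊂ J, [J:J'] = q², J' right O-stable} g J' = a_q(E)·g J` for primes `q ∤ N`
(the Hecke operators `T_q`, §2.2); HERE over `ℤ` (no level raising: `k = ∞`, `L = 1`): `φ : RI → ℤ`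
is `IsEig`, non-zero, and GENERATES the ℤ-module of `IsEig` functionals (`∀ g, IsEig g → ∃ u : ℤ,
g = u·φ` on `RI`) — this is "`ψ_g` surjective onto `ℤ_p`, 𝐓-equivariant, unique up to a unit" for
every `p` at once (an anemic-`𝐓` eigenfunctional is a full-`𝐓` one: `U_q φ` is again `IsEig`, hence a
multiple of `φ`); a Gross point of conductor `1` is `(ψ, I)`, `I ∈ RI`, `ψ : K → B` with `ψ(𝒪_K) I ⊆ I`
optimally (= an optimal embedding of `𝒪_K` into the left order of `I`, §2.4 with `n = 0`); its
`Pic(𝒪_K)`-orbit is `[𝔞] ↦ ψ(𝔞)·I` (§2.4 "`g f̂(𝔞) × f`"), so `ψ_f(P_K) = Σ_{[𝔞]} φ(ψ(rep 𝔞)·I)`.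

Reading steps recorded, not hidden (cf. the two of `BipartiteToricPeriod.lean`): (i) `Sel(K, A_f(𝟙))`
of §5.2.5 is the classical `Sel_{p^∞}(E/K)`: away from `pN⁻` the conditions coincide (trivial at `N⁺`,
unramified = trivial at good `v ∤ p` for `E[p^∞]`); at `λ ∣ N⁻` "ordinary" is the image of
`H¹(K_λ, μ_{p^∞}) → H¹(K_λ, E[p^∞])`, which is `0` because the connecting map
`E[p^∞]/μ = ℚ_p/ℤ_p → H¹(K_λ, μ_{p^∞}) = K_λ^× ⊗ ℚ_p/ℤ_p ≅ ℚ_p/ℤ_p` (Tate curve) is onto, and the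
classical condition at `λ ∤ p` is `0` as well (`E(K_λ) ⊗ ℚ_p/ℤ_p = 0`); at `𝔭 ∣ p` the classes finite
in `K_{∞,𝔭}` are the Kummer classes by the paper's own Prop. 5.3 and the absence of `p`-torsion in
`E(K_{∞,𝔭})` (`a_p ≢ ±1`) — and the Introduction names them "the standard Selmer groups";
(ii) `ψ_f` on `J ⊗ ℤ_p` is `φ ⊗ ℤ_p` up to `ℤ_p^×` because `φ` generates the integral eigenline.

## READING FLAGS (for the referee; the fact is the printed Theorem B under the printed Hypothesis 1.1)

RF1. The arXiv text's §3 opens "Fix a squarefree positive integer `N` … and a rational prime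
`p > 5`" [p0008 L3] and its level-raising Theorem 3.3 is stated under Hypothesis 3.2 "`ρ̄_f`
surjective" [p0008 L92–L98], whereas the main theorems are stated under Hypothesis 1.1 (`p ⩾ 5`,
`ρ̄` irreducible, `N⁺` arbitrary with bullet 5).  RF2. §4.1 [p0010 L44–L48]: "Hypothesis (1.1) imply
that Hypothesis CR in [P-W] holds true, so according to Theorem 6.2 and Proposition 6.5 of [P-W] …
`J_{𝔪_L}` is a free `𝐓_{𝔪_L}`-module of rank one"; Pollack–Weston's printed CR includes surjectivity
(Compos. Math. 147 (2011) p. 1354; C.-H. Kim, Asian J. Math. 21 (2017) Rem. 1.8: "the surjectivity is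
not required due to a group-theoretic argument of Chida–Hsieh unless `𝔽 = 𝔽₅`", CH15 Lemmas 6.1–6.2).
RF3. For the X9 consumers (`p = 5`, image `5S4`, `N⁻ = ℓ ∈ {2,3}` with `5 ∣ c_ℓ`) the two
group-theoretic conclusions CH15 §6 needs hold directly: `−1 ∈ im ρ̄` (the full preimage of `S₄`
contains the scalars) and `h = ρ̄(Frob_ℓ)` has eigenvalues `{1, ℓ}` with `ℓ ≢ ±1 (mod 5)`.
The lane's `CITED-FACTS` row records these; acquisition of the journal text is requested.

## References

* [BertoliniLongoVenerucci2026] Math. Ann. 2026, doi:10.1007/s00208-026-03381-0; [BertoliniLongoVenerucci2023] arXiv:2306.17784.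
* [BertoliniDarmon2005] Ann. of Math. 162 (2005) (`𝓛_f`, first/second reciprocity laws).
* [PollackWeston2011] Compos. Math. 147 (2011) §2.1 (`ψ_f`), §6; [Kim2024] (the tree's typing template).
* [Gross1987] §3, §11; [Vatsal2003] Lemma 2.5 (Gross' period `Ω`).
-/

namespace Literature.NumberTheory.EllipticCurves.BertoliniLongoVenerucci2026

open scoped BigOperators NumberField
open Literature.NumberTheory.GaloisRepresentations

/-- **Bertolini–Longo–Venerucci 2026, Theorem B at `χ = 𝟙` in the definite good-ordinary case, in
Gross-point form: `#Sel_{p^∞}(E/K) = p^{2·ord_p ψ_f(P_K)}` when `ψ_f(P_K) ≠ 0`.**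
Binders (module docstring for the dictionary).  Curve side (Hypothesis 1.1, definite): `W` a global
minimal model of `E/ℚ`; `p ⩾ 5` prime, good ORDINARY at `p` (`p ∤ a_p`), `a_p ≢ ±1 (mod p)`;
`ρ̄_{E,p}` irreducible; `K` imaginary quadratic with `(d_K, Np) = 1` and `p ∤ h_K`; `N = N⁺N⁻` coprime
factorisation of the conductor, primes of `N⁺` split and primes of `N⁻` inert in `K`, `N⁻` square-free
with an ODD number of prime factors; `H⁰(I_q, E[p]) = 0` for every prime `q ∣ N⁺` (inertia groups
`𝔓.inertia Γ_ℚ` at primes `𝔓 ∣ q` of `ℤ̄`, acting on `geomTorsion W p`); `ρ̄` ramified at every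
`q ∣ N⁻` with `q ≡ ±1 (mod p)`.  Quaternionic side (as in `kim_selmerCorank_baseChange_le_of_toricPeriod_ne_zero`
with `n = 1`): `B = (a,b)_ℚ` definite ramified exactly at the primes of `N⁻`; `O` Eichler of level
`N⁺`; `RI` the invertible right `O`-ideals; `IsEig`; `φ : RI → ℤ` an `IsEig` functional, non-zero,
generating the ℤ-module of `IsEig` functionals (`ψ_f`); `(ψ, I, rep)` a conductor-`1` Gross point with
ideal-class representatives.  Conclusion: with `S = Σ_{[𝔞] ∈ Cl_K} φ(ψ(rep 𝔞)·I)`, if `S ≠ 0` then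
`Nat.card (Sel_{p^∞}(E/K)) = p ^ (2 · ord_p S)`.  Printed: Thm. B "`length_{𝒪_χ}(Sel(K,A_f(χ)))
⩽ ord_χ(L(E/K,χ,1)/C)` with equality in the non-exceptional case", §9.2 Step 1
"`= 2·ord_χ(𝓛_{f,n}(χ̄))`", Lemma 4.1 "`𝓛_g(𝟙) = ψ_g(P_K(L))` … up to … `R^*`".
[cite: BertoliniLongoVenerucci2026, Thm. B with Hyp. 1.1, Thm. 7.1, Lemma 4.1, §9.2 Step 1, §2.4–2.5 (arXiv:2306.17784 p0003, p0026, p0010, p0040, p0006–p0007)]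
[cite: BertoliniLongoVenerucci2023, Thm. B] -/
def BLV2026_card_selmerGroupPInfty_eq_pow_of_grossPeriod : Prop :=
    ∀ (W : WeierstrassCurve ℚ) [W.IsElliptic] [W.IsGloballyMinimal] (p : ℕ) [Fact p.Prime] (Nplus
      Nminus : ℕ) (a b : ℚ) (O : Subring (QuaternionAlgebra ℚ a 0 b)) (K : Type) [Field K]
      [NumberField K] (ψ : K →ₐ[ℚ] QuaternionAlgebra ℚ a 0 b) (I : Submodule ℤ (QuaternionAlgebra ℚ
      a 0 b)) (φ : Submodule ℤ (QuaternionAlgebra ℚ a 0 b) → ℤ) (rep : ClassGroup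
      (NumberField.RingOfIntegers K) → nonZeroDivisors (Ideal (NumberField.RingOfIntegers K))) (RI :
      Set (Submodule ℤ (QuaternionAlgebra ℚ a 0 b))) (IsEig : (Submodule ℤ (QuaternionAlgebra ℚ a 0
      b) → ℤ) → Prop),
      ((5 ≤ p ∧ W.HasGoodReductionAtPrime p ∧ ¬ (p : ℤ) ∣ W.frobeniusTrace p ∧
          ¬ (p : ℤ) ∣ W.frobeniusTrace p - 1 ∧ ¬ (p : ℤ) ∣ W.frobeniusTrace p + 1 ∧
          W.HasIrreducibleModPGaloisRep p) ∧
        (Module.finrank ℚ K = 2 ∧ NumberField.IsTotallyComplex K ∧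
          Int.gcd (NumberField.discr K) (W.conductorNorm ℤ * p) = 1 ∧
          ¬ p ∣ Fintype.card (ClassGroup (NumberField.RingOfIntegers K))) ∧
        (W.conductorNorm ℤ = Nplus * Nminus ∧ Nat.Coprime Nplus Nminus ∧ Squarefree Nminus ∧
          Odd Nminus.primeFactors.card ∧
          (∀ q : ℕ, q.Prime → q ∣ Nplus →
            ((Ideal.span {(q : ℤ)}).primesOver (NumberField.RingOfIntegers K)).ncard = 2) ∧
          (∀ q : ℕ, q.Prime → q ∣ Nminus →
            ((Ideal.span {(q : ℤ)}).primesOver (NumberField.RingOfIntegers K)).ncard = 1)) ∧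
        ((∀ q : ℕ, q.Prime → q ∣ Nplus → ∀ v : IsDedekindDomain.HeightOneSpectrum (𝓞 ℚ),
            ((q : ℕ) : 𝓞 ℚ) ∈ v.asIdeal → ∀ 𝔓 ∈ v.primesAbove,
            ∀ P : W.geomTorsion (p : ℤ),
              (∀ σ ∈ 𝔓.inertia (Field.absoluteGaloisGroup ℚ), σ • P = P) → P = 0) ∧
          (∀ q : ℕ, q.Prime → q ∣ Nminus → ((p : ℤ) ∣ (q : ℤ) - 1 ∨ (p : ℤ) ∣ (q : ℤ) + 1) →
            ∃ v : IsDedekindDomain.HeightOneSpectrum (𝓞 ℚ), ((q : ℕ) : 𝓞 ℚ) ∈ v.asIdeal ∧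
              ∃ 𝔓 ∈ v.primesAbove, ∃ σ ∈ 𝔓.inertia (Field.absoluteGaloisGroup ℚ),
                ∃ P : W.geomTorsion (p : ℤ), σ • P ≠ P)) ∧
        (a < 0 ∧ b < 0 ∧ (∀ (q : ℕ) [Fact q.Prime],
          (∀ x : QuaternionAlgebra ℚ_[q] (a : ℚ_[q]) 0 (b : ℚ_[q]), x ≠ 0 → IsUnit x) ↔ q ∣ Nminus)) ∧
        (∃ O₁ O₂ : Subring (QuaternionAlgebra ℚ a 0 b), (∀ S : Subring (QuaternionAlgebra ℚ a 0 b),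
          (S = O₁ ∨ S = O₂) → (S.toAddSubgroup.FG ∧ (∀ d : QuaternionAlgebra ℚ a 0 b, ∃ m : ℤ, m ≠ 0 ∧
          m • d ∈ S) ∧ ∀ S' : Subring (QuaternionAlgebra ℚ a 0 b), S'.toAddSubgroup.FG → S ≤ S' →
          S' = S)) ∧ O = O₁ ⊓ O₂ ∧ O.toAddSubgroup.relIndex O₁.toAddSubgroup = Nplus) ∧
        ((∀ J : Submodule ℤ (QuaternionAlgebra ℚ a 0 b), J ∈ RI ↔ (J.FG ∧ (∀ d : QuaternionAlgebra ℚ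
          a 0 b, ∃ m : ℤ, m ≠ 0 ∧ m • d ∈ J) ∧ (∀ x : QuaternionAlgebra ℚ a 0 b, (∀ y ∈ J, y * x ∈ J)
          ↔ x ∈ O) ∧ (∃ J' : Submodule ℤ (QuaternionAlgebra ℚ a 0 b), (∀ x : QuaternionAlgebra ℚ a
          0 b, x ∈ J * J' ↔ ∀ y ∈ J, x * y ∈ J) ∧ (∀ x : QuaternionAlgebra ℚ a 0 b, x ∈ J' * J ↔ x ∈
          O)))) ∧ (∀ g : Submodule ℤ (QuaternionAlgebra ℚ a 0 b) → ℤ, IsEig g ↔ ((∀ J ∈ RI, ∀ β :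
          QuaternionAlgebra ℚ a 0 b, IsUnit β → g (J.map (AddMonoidHom.mulLeft β).toIntLinearMap) =
          g J) ∧ (∀ q : ℕ, q.Prime → ¬ q ∣ W.conductorNorm ℤ → ∀ J ∈ RI, ∑ᶠ J' ∈ {J' : Submodule ℤ
          (QuaternionAlgebra ℚ a 0 b) | J' ≤ J ∧ J'.toAddSubgroup.relIndex J.toAddSubgroup = q ^ 2 ∧
          ∀ y ∈ J', ∀ x ∈ O, y * x ∈ J'}, g J' = (W.frobeniusTrace q : ℤ) * g J))) ∧ IsEig φ ∧
          (∃ J ∈ RI, φ J ≠ 0) ∧ (∀ g : Submodule ℤ (QuaternionAlgebra ℚ a 0 b) → ℤ, IsEig g →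
          ∃ u : ℤ, ∀ J ∈ RI, g J = u * φ J)) ∧
        (I ∈ RI ∧ (∀ x : NumberField.RingOfIntegers K, ∀ y ∈ I, ψ (x : K) * y ∈ I) ∧ (∀ x : K, (∀ y
          ∈ I, ψ x * y ∈ I) → ∃ z : NumberField.RingOfIntegers K, (z : K) = x) ∧ (∀ 𝔞 : ClassGroup
          (NumberField.RingOfIntegers K), ClassGroup.mk0 (rep 𝔞) = 𝔞))) →
      (∑ 𝔞 : ClassGroup (NumberField.RingOfIntegers K), φ (Submodule.span ℤ ((fun x :
        NumberField.RingOfIntegers K => ψ (x : K)) '' ((rep 𝔞 : nonZeroDivisors (Ideal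
        (NumberField.RingOfIntegers K))) : Ideal (NumberField.RingOfIntegers K))) * I)) ≠ 0 →
      Nat.card ((W.baseChange K).selmerGroupPInfty p) =
        p ^ (2 * padicValInt p (∑ 𝔞 : ClassGroup (NumberField.RingOfIntegers K), φ (Submodule.span ℤ
          ((fun x : NumberField.RingOfIntegers K => ψ (x : K)) '' ((rep 𝔞 : nonZeroDivisors (Ideal
          (NumberField.RingOfIntegers K))) : Ideal (NumberField.RingOfIntegers K))) * I)))

/-- **The unit case: `p ∤ ψ_f(P_K) ⟹ Sel_{p^∞}(E/K) = 0`** (PROVED from the fact: the exponent is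
`2·ord_p S = 0`, so `Sel_{p^∞}(E/K)` has one element). [cite: BertoliniLongoVenerucci2026, Thm. B (n = 0)] -/
theorem selmerGroupPInfty_baseChange_eq_bot_of_BLV2026
    (h : BLV2026_card_selmerGroupPInfty_eq_pow_of_grossPeriod)
    (W : WeierstrassCurve ℚ) [W.IsElliptic] [W.IsGloballyMinimal] (p : ℕ) [Fact p.Prime] (Nplus
      Nminus : ℕ) (a b : ℚ) (O : Subring (QuaternionAlgebra ℚ a 0 b)) (K : Type) [Field K]
      [NumberField K] (ψ : K →ₐ[ℚ] QuaternionAlgebra ℚ a 0 b) (I : Submodule ℤ (QuaternionAlgebra ℚ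
      a 0 b)) (φ : Submodule ℤ (QuaternionAlgebra ℚ a 0 b) → ℤ) (rep : ClassGroup
      (NumberField.RingOfIntegers K) → nonZeroDivisors (Ideal (NumberField.RingOfIntegers K))) (RI :
      Set (Submodule ℤ (QuaternionAlgebra ℚ a 0 b))) (IsEig : (Submodule ℤ (QuaternionAlgebra ℚ a 0
      b) → ℤ) → Prop)
    (hyp : (5 ≤ p ∧ W.HasGoodReductionAtPrime p ∧ ¬ (p : ℤ) ∣ W.frobeniusTrace p ∧
          ¬ (p : ℤ) ∣ W.frobeniusTrace p - 1 ∧ ¬ (p : ℤ) ∣ W.frobeniusTrace p + 1 ∧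
          W.HasIrreducibleModPGaloisRep p) ∧
        (Module.finrank ℚ K = 2 ∧ NumberField.IsTotallyComplex K ∧
          Int.gcd (NumberField.discr K) (W.conductorNorm ℤ * p) = 1 ∧
          ¬ p ∣ Fintype.card (ClassGroup (NumberField.RingOfIntegers K))) ∧
        (W.conductorNorm ℤ = Nplus * Nminus ∧ Nat.Coprime Nplus Nminus ∧ Squarefree Nminus ∧
          Odd Nminus.primeFactors.card ∧
          (∀ q : ℕ, q.Prime → q ∣ Nplus →
            ((Ideal.span {(q : ℤ)}).primesOver (NumberField.RingOfIntegers K)).ncard = 2) ∧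
          (∀ q : ℕ, q.Prime → q ∣ Nminus →
            ((Ideal.span {(q : ℤ)}).primesOver (NumberField.RingOfIntegers K)).ncard = 1)) ∧
        ((∀ q : ℕ, q.Prime → q ∣ Nplus → ∀ v : IsDedekindDomain.HeightOneSpectrum (𝓞 ℚ),
            ((q : ℕ) : 𝓞 ℚ) ∈ v.asIdeal → ∀ 𝔓 ∈ v.primesAbove,
            ∀ P : W.geomTorsion (p : ℤ),
              (∀ σ ∈ 𝔓.inertia (Field.absoluteGaloisGroup ℚ), σ • P = P) → P = 0) ∧
          (∀ q : ℕ, q.Prime → q ∣ Nminus → ((p : ℤ) ∣ (q : ℤ) - 1 ∨ (p : ℤ) ∣ (q : ℤ) + 1) →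
            ∃ v : IsDedekindDomain.HeightOneSpectrum (𝓞 ℚ), ((q : ℕ) : 𝓞 ℚ) ∈ v.asIdeal ∧
              ∃ 𝔓 ∈ v.primesAbove, ∃ σ ∈ 𝔓.inertia (Field.absoluteGaloisGroup ℚ),
                ∃ P : W.geomTorsion (p : ℤ), σ • P ≠ P)) ∧
        (a < 0 ∧ b < 0 ∧ (∀ (q : ℕ) [Fact q.Prime],
          (∀ x : QuaternionAlgebra ℚ_[q] (a : ℚ_[q]) 0 (b : ℚ_[q]), x ≠ 0 → IsUnit x) ↔ q ∣ Nminus)) ∧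
        (∃ O₁ O₂ : Subring (QuaternionAlgebra ℚ a 0 b), (∀ S : Subring (QuaternionAlgebra ℚ a 0 b),
          (S = O₁ ∨ S = O₂) → (S.toAddSubgroup.FG ∧ (∀ d : QuaternionAlgebra ℚ a 0 b, ∃ m : ℤ, m ≠ 0 ∧
          m • d ∈ S) ∧ ∀ S' : Subring (QuaternionAlgebra ℚ a 0 b), S'.toAddSubgroup.FG → S ≤ S' →
          S' = S)) ∧ O = O₁ ⊓ O₂ ∧ O.toAddSubgroup.relIndex O₁.toAddSubgroup = Nplus) ∧
        ((∀ J : Submodule ℤ (QuaternionAlgebra ℚ a 0 b), J ∈ RI ↔ (J.FG ∧ (∀ d : QuaternionAlgebra ℚ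
          a 0 b, ∃ m : ℤ, m ≠ 0 ∧ m • d ∈ J) ∧ (∀ x : QuaternionAlgebra ℚ a 0 b, (∀ y ∈ J, y * x ∈ J)
          ↔ x ∈ O) ∧ (∃ J' : Submodule ℤ (QuaternionAlgebra ℚ a 0 b), (∀ x : QuaternionAlgebra ℚ a
          0 b, x ∈ J * J' ↔ ∀ y ∈ J, x * y ∈ J) ∧ (∀ x : QuaternionAlgebra ℚ a 0 b, x ∈ J' * J ↔ x ∈
          O)))) ∧ (∀ g : Submodule ℤ (QuaternionAlgebra ℚ a 0 b) → ℤ, IsEig g ↔ ((∀ J ∈ RI, ∀ β :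
          QuaternionAlgebra ℚ a 0 b, IsUnit β → g (J.map (AddMonoidHom.mulLeft β).toIntLinearMap) =
          g J) ∧ (∀ q : ℕ, q.Prime → ¬ q ∣ W.conductorNorm ℤ → ∀ J ∈ RI, ∑ᶠ J' ∈ {J' : Submodule ℤ
          (QuaternionAlgebra ℚ a 0 b) | J' ≤ J ∧ J'.toAddSubgroup.relIndex J.toAddSubgroup = q ^ 2 ∧
          ∀ y ∈ J', ∀ x ∈ O, y * x ∈ J'}, g J' = (W.frobeniusTrace q : ℤ) * g J))) ∧ IsEig φ ∧
          (∃ J ∈ RI, φ J ≠ 0) ∧ (∀ g : Submodule ℤ (QuaternionAlgebra ℚ a 0 b) → ℤ, IsEig g →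
          ∃ u : ℤ, ∀ J ∈ RI, g J = u * φ J)) ∧
        (I ∈ RI ∧ (∀ x : NumberField.RingOfIntegers K, ∀ y ∈ I, ψ (x : K) * y ∈ I) ∧ (∀ x : K, (∀ y
          ∈ I, ψ x * y ∈ I) → ∃ z : NumberField.RingOfIntegers K, (z : K) = x) ∧ (∀ 𝔞 : ClassGroup
          (NumberField.RingOfIntegers K), ClassGroup.mk0 (rep 𝔞) = 𝔞)))
    (hunit : ¬ (p : ℤ) ∣ ∑ 𝔞 : ClassGroup (NumberField.RingOfIntegers K), φ (Submodule.span ℤ ((fun x :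
        NumberField.RingOfIntegers K => ψ (x : K)) '' ((rep 𝔞 : nonZeroDivisors (Ideal
        (NumberField.RingOfIntegers K))) : Ideal (NumberField.RingOfIntegers K))) * I)) :
    (W.baseChange K).selmerGroupPInfty p = ⊥ := by
  set S := ∑ 𝔞 : ClassGroup (NumberField.RingOfIntegers K), φ (Submodule.span ℤ ((fun x :
        NumberField.RingOfIntegers K => ψ (x : K)) '' ((rep 𝔞 : nonZeroDivisors (Ideal
        (NumberField.RingOfIntegers K))) : Ideal (NumberField.RingOfIntegers K))) * I) with hS
  have hS0 : S ≠ 0 := fun h0 => hunit (by rw [h0]; exact dvd_zero _)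
  have hcard := h W p Nplus Nminus a b O K ψ I φ rep RI IsEig hyp hS0
  have hv : padicValInt p S = 0 := by
    rw [padicValInt, padicValNat.eq_zero_of_not_dvd]
    rw [← Int.natCast_dvd]
    exact hunit
  rw [hv, mul_zero, pow_zero] at hcard
  exact AddSubgroup.eq_bot_of_card_eq _ hcard

end Literature.NumberTheory.EllipticCurves.BertoliniLongoVenerucci2026
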